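import Mathlib
import HarnessLib
import Summits.CriticalPhenomena.CardyFormulaZ2.Theses.CardySelfRefinement
import Summits.CriticalPhenomena.CardyFormulaZ2.Theorems.CardySelfRefinementSymmetryUpgradeRExitRigidity
import Summits.CriticalPhenomena.CardyFormulaZ2.Theorems.CardySelfRefinementSymmetryUpgradeRExitModulusMap
import Literature.Probability.RandomPlanarGeometry.ChordalReversibility
import Literature.Probability.RandomPlanarGeometry.ConformalRectangle
import Literature.Probability.RandomPlanarGeometry.IsometryCovariance
import Literature.Probability.RandomPlanarGeometry.ModulusSymmetry

/-!
# Crux `SymmetryUpgradeR` (stmt-CriticalPhenomena-17239), line `SketchIdeatorTwo` — helper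
# `exitRigidity_exitFunctionOfModulus` for stub `stub_exitRigidity` (FL4): the exit function exists

**The exit probability `h_P(R) = P_{(Ω; a, c)}(γ hits (cd) before (bc))` of a conformally
covariant chordal family is a function of the conformal modulus (Cardy's cross-ratio) on each
boundary-orientation class of conformal rectangles; with reflection covariance
(`IsIsometryCovariant`) it is a function of the modulus alone.** This is the "exit function
`F_P` exists" half of FL4 of idea card `swallowing-skeleton-rs-pin` (the other half — rigidity:
renewal consistency + touch exponent `1/3` force `F_P = ` Cardy's function — is new mathematics,
not attempted here). Ingredients: `exitRigidity_imageDataOfModulus` (two rectangles of equal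
modulus and orientation are univalent image data of one another, Pommerenke 1992 §2.3 Ex. 2 +
Thm. 2.6), `exitRigidity_exitFunction` (invariance of `h_P` under univalent image data, from
conformal covariance), and for the orientation switch the reflected uniformizing datum
(`exists_isUniformizing_conj`, Ahlfors 1979 Ch. 4 §6.5) with `exitRigidity_exitFunction_isometry`.

Why orientation enters: a conformal map preserves the boundary orientation, and under conformal
covariance alone a chiral family may have different exit functions on the two classes (e.g. the
deterministic family "trace the boundary arc from `a` to `b` with the domain on the left" is
conformally covariant and chordal, with exit probabilities `0` and `1` at modulus `1/2` on the
two classes); the stub `stub_exitRigidity` carries `IsIsometryCovariant` for this reason.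

## References

* Ch. Pommerenke, *Boundary Behaviour of Conformal Maps* (1992), Thm. 2.6, §2.3 Exercise 2.
* L. V. Ahlfors, *Complex Analysis*, 3rd ed. (1979), Ch. 4 §6.5, Ch. 6 §1.1.
* W. Werner, *Lectures on two-dimensional critical percolation* (2007), §3.
-/

noncomputable section

namespace Summit.CriticalPhenomena.CardyFormulaZ2.Theorems.SymmetryUpgradeR.SwallowingSkeleton

open MeasureTheory Filter Set Metric Topology
open Literature.Probability.RandomPlanarGeometry Literature.Probability.LatticeModels
  Literature.Probability.Percolation
open UpperHalfPlane (upperHalfPlaneSet)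

/-! ### The reflected uniformizing datum -/

open scoped ComplexConjugate in
/-- **Uniformizing the mirror image.** If `(ψ, y)` uniformizes `S` then
`(z ↦ conj (ψ (-z̄)), -y)` uniformizes the reflected rectangle `S̄ = S.map conj` (two orientation
reversals compose to a conformal map; the boundary tuple `-y` has the opposite orientation type).
Ahlfors 1979, Ch. 4 §6.5. -/
theorem exists_isUniformizing_conj (S : ConformalRectangle)
    (ψ : ConformalEquiv upperHalfPlaneSet S.carrier) (y : Fin 4 → ℝ) (hψ : S.IsUniformizing ψ y) :
    ∃ ψ' : ConformalEquiv upperHalfPlaneSet (S.map Complex.conjLIE.toHomeomorph).carrier,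
      (S.map Complex.conjLIE.toHomeomorph).IsUniformizing ψ' (-y) := by
  have hcar : (S.map Complex.conjLIE.toHomeomorph).carrier = conj '' S.carrier := rfl
  have hmem : ∀ w, w ∈ conj '' S.carrier ↔ conj w ∈ S.carrier := fun w => by
    constructor
    · rintro ⟨u, hu, rfl⟩
      simpa using hu
    · intro h
      exact ⟨conj w, h, by simp⟩
  have hop : IsOpen (conj '' S.carrier) :=
    (Complex.conjLIE.toHomeomorph : ℂ ≃ₜ ℂ).isOpenMap _ S.isOpen
  refine ⟨{ toFun := fun z => conj (ψ (-conj z))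
            invFun := fun w => -conj (ψ.symm (conj w))
            source := upperHalfPlaneSet
            target := (S.map Complex.conjLIE.toHomeomorph).carrier
            map_source' := fun z hz => ?_
            map_target' := fun w hw => ?_
            left_inv' := fun z hz => ?_
            right_inv' := fun w hw => ?_
            source_eq := rfl
            target_eq := rfl
            differentiableOn := ?_
            differentiableOn_symm := ?_ }, ?_, fun i => ?_⟩
  · rw [hcar, hmem, Complex.conj_conj]
    exact ψ.mapsTo (neg_conj_mem_upperHalfPlaneSet hz)
  · rw [hcar, hmem] at hw
    exact neg_conj_mem_upperHalfPlaneSet (ψ.symm_mapsTo hw)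
  · simp only [Complex.conj_conj]
    rw [ψ.symm_apply_apply (neg_conj_mem_upperHalfPlaneSet hz)]
    simp
  · rw [hcar, hmem] at hw
    simp only [map_neg, Complex.conj_conj, neg_neg]
    rw [ψ.apply_symm_apply hw, Complex.conj_conj]
  · intro z hz
    have hz' : -conj z ∈ upperHalfPlaneSet := neg_conj_mem_upperHalfPlaneSet hz
    have h1 : DifferentiableAt ℂ (conj ∘ (fun u => ψ (-u)) ∘ conj) z := by
      rw [differentiableAt_conj_conj_iff]
      have hψd : DifferentiableAt ℂ ψ (-conj z) :=
        (ψ.differentiableOn_coe _ hz').differentiableAt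
          (UpperHalfPlane.isOpen_upperHalfPlaneSet.mem_nhds hz')
      exact hψd.comp _ (differentiable_neg _)
    exact h1.differentiableWithinAt
  · show DifferentiableOn ℂ (fun w => -conj (ψ.symm (conj w)))
      (S.map Complex.conjLIE.toHomeomorph).carrier
    rw [hcar]
    intro w hw
    have hw' : conj w ∈ S.carrier := (hmem w).1 hw
    have h1 : DifferentiableAt ℂ (conj ∘ (fun u => ψ.symm u) ∘ conj) w := by
      rw [differentiableAt_conj_conj_iff]
      exact (ψ.symm.differentiableOn_coe _ hw').differentiableAt (S.isOpen.mem_nhds hw')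
    exact h1.neg.differentiableWithinAt
  · rcases hψ.1 with h | h
    · exact Or.inr h.neg
    · exact Or.inl h.neg
  · -- boundary values: `conj ∘ ψ ∘ κ → conj (S.pt i)` at `-y i`
    show Tendsto (fun z => conj (ψ (-conj z))) (𝓝[upperHalfPlaneSet] (((-y) i : ℝ) : ℂ))
      (𝓝 ((S.map Complex.conjLIE.toHomeomorph).pt i))
    rw [MarkedDomain.pt_map]
    have hκ : Tendsto (fun z : ℂ => -conj z) (𝓝[upperHalfPlaneSet] (((-y) i : ℝ) : ℂ))
        (𝓝[upperHalfPlaneSet] (y i : ℂ)) := by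
      have hc : Continuous fun z : ℂ => -conj z := by fun_prop
      have h1 : Tendsto (fun z : ℂ => -conj z) (𝓝 (((-y) i : ℝ) : ℂ)) (𝓝 (y i : ℂ)) := by
        have := hc.tendsto (((-y) i : ℝ) : ℂ)
        simpa [Complex.conj_ofReal] using this
      refine tendsto_nhdsWithin_of_tendsto_nhds_of_eventually_within _
        (h1.mono_left nhdsWithin_le_nhds) ?_
      exact eventually_mem_nhdsWithin.mono fun z hz => neg_conj_mem_upperHalfPlaneSet hz
    have hρ : Tendsto (fun w : ℂ => conj w) (𝓝 (S.pt i))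
        (𝓝 ((Complex.conjLIE.toHomeomorph : ℂ ≃ₜ ℂ) (S.pt i))) :=
      Complex.continuous_conj.tendsto (S.pt i)
    exact hρ.comp ((hψ.2 i).comp hκ)

/-! ### The exit function -/

/-- Registered helper `exitRigidity_exitFunctionOfModulus` (for stub `stub_exitRigidity`, line
`SketchIdeatorTwo` of crux stmt-CriticalPhenomena-17239). **The exit probability of a conformally
covariant chordal family is a function of the conformal modulus on each orientation class**: if
`R`, `S` are conformal rectangles with uniformizing data `(φ, x)`, `(ψ, y)` of the same
orientation type (`x` increasing iff `y` increasing) and the same Cardy cross-ratio, then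
`P_{(R; a, c)}(γ hits (cd) before (bc)) = P_{(S; a', c')}(γ hits (c'd') before (b'c'))`.
(`exitRigidity_imageDataOfModulus` + `exitRigidity_exitFunction`.) The orientation hypothesis
cannot be dropped under conformal covariance alone (a chiral conformally covariant family, e.g.
"trace the boundary arc with the domain on the left", has exit probabilities `0` and `1` on the
two orientation classes at modulus `1/2`); reflection covariance removes it
(`exitRigidity_exitFunctionOfModulus_isometry`). -/
theorem exitRigidity_exitFunctionOfModulus : ∀ P : ChordalFamily, P.IsChordal → P.IsConformallyCovariant → ∀ (R S : ConformalRectangle) (φ : ConformalEquiv upperHalfPlaneSet R.carrier) (ψ : ConformalEquiv upperHalfPlaneSet S.carrier) (x y : Fin 4 → ℝ), R.IsUniformizing φ x → S.IsUniformizing ψ y → (StrictMono x ↔ StrictMono y) → crossRatio x = crossRatio y → (P (R.chord 0 2 (by decide))).real (CurveClass.hitsBefore (R.arc 2) (R.arc 1)) = (P (S.chord 0 2 (by decide))).real (CurveClass.hitsBefore (S.arc 2) (S.arc 1)) := by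
  intro P hP hcov R S φ ψ x y hφ hψ hiff hcr
  have h01 : (0 : Fin 4) < 1 := by decide
  have hor : (StrictMono x ∧ StrictMono y) ∨ (StrictAnti x ∧ StrictAnti y) := by
    rcases hφ.1 with hx | hx
    · exact Or.inl ⟨hx, hiff.1 hx⟩
    · refine Or.inr ⟨hx, ?_⟩
      rcases hψ.1 with hy | hy
      · exact absurd (hiff.2 hy h01) (not_lt.2 (hx h01).le)
      · exact hy
  obtain ⟨Φ, hd, hi, hS, hpt, h1, h2⟩ :=
    exitRigidity_imageDataOfModulus R S φ ψ x y hφ hψ hor hcr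
  exact exitRigidity_exitFunction P hP hcov R S Φ hd hi hS (hpt 0) (hpt 2) h1 h2

/-- **With reflection covariance the exit probability is a function of the modulus alone.** For
a chordal family that is conformally covariant and isometry covariant (`IsIsometryCovariant`,
covariance under the reflections of the plane), any two conformal rectangles with uniformizing
data of the same Cardy cross-ratio have the same exit probability: when the orientation types
differ, reflect `S` in the real axis (`exists_isUniformizing_conj`: the mirror image carries the
datum `-y`, of the other type and the same cross-ratio, `crossRatio_neg`) and use
`exitRigidity_exitFunction_isometry`. This is the precise sense in which the exit function `F_P`
of idea card `swallowing-skeleton-rs-pin` (FL4) exists for the families of stub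
`stub_exitRigidity`. -/
theorem exitRigidity_exitFunctionOfModulus_isometry : ∀ P : ChordalFamily, P.IsChordal →
    P.IsConformallyCovariant → P.IsIsometryCovariant →
    ∀ (R S : ConformalRectangle) (φ : ConformalEquiv upperHalfPlaneSet R.carrier)
      (ψ : ConformalEquiv upperHalfPlaneSet S.carrier) (x y : Fin 4 → ℝ),
      R.IsUniformizing φ x → S.IsUniformizing ψ y → crossRatio x = crossRatio y →
      (P (R.chord 0 2 (by decide))).real (CurveClass.hitsBefore (R.arc 2) (R.arc 1)) =
        (P (S.chord 0 2 (by decide))).real (CurveClass.hitsBefore (S.arc 2) (S.arc 1)) := by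
  intro P hP hcov hiso R S φ ψ x y hφ hψ hcr
  by_cases hiff : (StrictMono x ↔ StrictMono y)
  · exact exitRigidity_exitFunctionOfModulus P hP hcov R S φ ψ x y hφ hψ hiff hcr
  · obtain ⟨ψ', hψ'⟩ := exists_isUniformizing_conj S ψ y hψ
    have h01 : (0 : Fin 4) < 1 := by decide
    have key : ∀ f : Fin 4 → ℝ, StrictMono f → StrictAnti f → False := fun f hf hf' =>
      lt_asymm (hf h01) (hf' h01)
    have hiff' : StrictMono x ↔ StrictMono (-y) := by
      rcases hφ.1 with hx | hx <;> rcases hψ.1 with hy | hy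
      · exact absurd (iff_of_true hx hy) hiff
      · exact iff_of_true hx hy.neg
      · refine ⟨fun h => (key x h hx).elim, fun h => (key _ h ?_).elim⟩
        exact hy.neg
      · exact absurd ⟨fun h => (key x h hx).elim, fun h => (key y h hy).elim⟩ hiff
    have h1 := exitRigidity_exitFunctionOfModulus P hP hcov R _ φ ψ' x (-y) hφ hψ' hiff'
      (by rw [crossRatio_neg]; exact hcr)
    exact h1.trans (exitRigidity_exitFunction_isometry P hiso S _ isometry_conjLIE_toHomeomorph)

end Summit.CriticalPhenomena.CardyFormulaZ2.Theorems.SymmetryUpgradeR.SwallowingSkeleton
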